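import Summits.Ventures.Crystal3D.Theorems.StickyWulffConstantNoReconstructionGainPredSlotBudgetPairs
import HarnessLib

/-!
# The pred-slot budget when the up-triple is `ν`-below: the landed cap budget read backwards

HONEST FRAMING. Part of the venture `Summits/Ventures/Crystal3D` (cell `crystal3d-full`), helper
`--supports` the crux `NoReconstructionGain` (stmt-Ventures-19144, route
`route-Ventures-StickyWulffConstant`), line `adhesion` (wulff-p1 g14).  THIS FILE CLOSES THE BRICK
`predSlotBudget_of_upTriple_below` (B1a) OF SKELETON v20 BY NAME: the registered pred-slot budget
`stub_predSlotBudget70` of g13 (for a moved Barlow grain whose stacking axis is within `70.5°` of `−ν`: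
`#K ≤ #`credited directions among the three `ν`-lower hex bonds and the three up bonds, for `≤ 3` substrate
contacts `K` at lattice angles, `ν`-below by the ball's height `t`) in the case that the three up bonds
`A·pos_ε(1, −o)` are STRICTLY `ν`-BELOW — which is automatic in the open basal cone `⟪ν, A e₃⟫ < −1/√3`
and holds in part of the band `54.7°–70.5°`.  Skeleton v20 composes `stub_predSlotBudget70` from B1a and
the remaining brick B1b (`predSlotBudget_of_upBond_raised`: some up bond raised).

Method: no new spherical geometry.  The landed cap budget `stub_frameCapBudget`
(`…GrainFrameBudgetThree`, g12) of the twelve-direction star `A U₀` — for letter `ε = −1` of the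
half-turn frame `A ∘ R_π`, whose up-triple is `A·T₋₁` and whose hex bonds are the same up to sign — is
evaluated on the explicit star (`frameCapBudget_sum_le`) and compared antipodal pair by antipodal pair
with the pred-slot credits (`pair_hex_le`, `pair_hex_le'`, `pair_down_le`): a strictly-down up bond
carries exactly its landed credit, a hex pair loses at most `½`, and only when it is LEVEL.  One level
hex pair is absorbed by integrality (`natCast_le_of_le_indicators_add_half`); two level hex pairs force
`ν = −A e₃`, where the three up bonds alone carry the budget (`predSlotBudget_axis`: all submerged if
`t ≤ √(2/3)`, else each contact blocks two of them — `upBonds_two_blocked` — and three contacts block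
all three — `upBond_blocked_of_three`, a half-plane/obtuse-angle argument).

* `card_filter_toFinset_le_sum`, `image_toFinset_eq_map` — counting over an explicit list.
* `frameCapBudget_sum_le` — the landed budget as a twelve-term sum of indicators.
* `pair_hex_le`, `pair_hex_le'`, `pair_down_le` — the pair comparisons; `natCast_le_of_le_indicators_add_half`.
* `hexUp_inner_apply`, `upBonds_eq_neg`, `halfTurn_eq`, `halfTurn_bonds` — coordinates; the half-turn.
* `upBonds_two_blocked`, `not_three_neg_products`, `upBond_blocked_of_three`, `predSlotBudget_axis` —
  the axis-parallel normal.
* `predSlotBudget_core` — the budget in a frame whose up-triple is `ν`-below, hex representatives `±A h_j`.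
* `predSlotBudget_of_upTriple_below` (**the registered brick B1a, by name**).

WHAT THIS IS NOT: the raised-bond case B1b (the rest of the band `54.7°–70.5°`) is open (census-certified
with the whole brick: kit j310347/j310576/j311106/j311309, lead memo PREDBUDGET-g13.md); the crux on cores
`stub_adhesion_core` is untouched; rung F-C1 not moved.
-/

noncomputable section

namespace Summit.Ventures.Crystal3D.Theorems

open Summit.Ventures.Crystal3D Finset
open Literature.MathematicalPhysics.StatisticalMechanics (fccStacking barlowPos constHagg barlowPos_mem
  threeOffsets barlowPos_apply_zero barlowPos_apply_one barlowPos_apply_two haggLabel_const)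
open Literature.Algebra.EuclideanLattices (inner_fin_three norm_sq_fin_three)
open scoped InnerProductSpace

/-! ### The axis-parallel normal `ν = −A e₃` -/

/-- **The budget at the axis-parallel normal.**  If `A⁻¹ ν = −e₃` then already the three up bonds carry
`#K` credits: all three are submerged when `t ≤ √(2/3)`; otherwise every contact blocks two of them
(`upBonds_two_blocked`) and three contacts block all three (`upBond_blocked_of_three`). -/
theorem predSlotBudget_axis (A : EuclideanSpace ℝ (Fin 3) ≃ₗᵢ[ℝ] EuclideanSpace ℝ (Fin 3))
    (ν : EuclideanSpace ℝ (Fin 3)) (t : ℝ)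
    (K : Finset (EuclideanSpace ℝ (Fin 3))) (hK : K.card ≤ 3)
    (hK1 : ∀ u ∈ K, ‖u‖ = 1 ∧ ⟪u, ν⟫_ℝ ≤ -t) (hK2 : ∀ u ∈ K, ∀ u' ∈ K, u ≠ u' → ⟪u, u'⟫_ℝ ≤ 1 / 2)
    (h0 : (A.symm ν) 0 = 0) (h1 : (A.symm ν) 1 = 0) (h2 : (A.symm ν) 2 = -1) :
    (K.card : ℝ) ≤ (if (∃ u ∈ K, 1 / 2 < ⟪u, A (barlowPos 1 (Real.sqrt (2 / 3)) constHagg 1 0 0)⟫_ℝ) ∨ ⟪A (barlowPos 1 (Real.sqrt (2 / 3)) constHagg 1 0 0), ν⟫_ℝ ≤ -t then (1 : ℝ) else 0) +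
      (if (∃ u ∈ K, 1 / 2 < ⟪u, A (barlowPos 1 (Real.sqrt (2 / 3)) constHagg 1 (-1) 0)⟫_ℝ) ∨ ⟪A (barlowPos 1 (Real.sqrt (2 / 3)) constHagg 1 (-1) 0), ν⟫_ℝ ≤ -t then (1 : ℝ) else 0) +
      (if (∃ u ∈ K, 1 / 2 < ⟪u, A (barlowPos 1 (Real.sqrt (2 / 3)) constHagg 1 0 (-1))⟫_ℝ) ∨ ⟪A (barlowPos 1 (Real.sqrt (2 / 3)) constHagg 1 0 (-1)), ν⟫_ℝ ≤ -t then (1 : ℝ) else 0) := by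
  have key : ∀ x, ⟪A x, ν⟫_ℝ = ⟪x, A.symm ν⟫_ℝ := fun x => by
    rw [← A.inner_map_map x (A.symm ν), LinearIsometryEquiv.apply_symm_apply]
  have key2 : ∀ u x, ⟪u, A x⟫_ℝ = ⟪x, A.symm u⟫_ℝ := fun u x => by
    rw [real_inner_comm (A.symm u) x, ← A.inner_map_map (A.symm u) x, LinearIsometryEquiv.apply_symm_apply]
  have hpos : 0 < Real.sqrt (2 / 3) := Real.sqrt_pos.2 (by norm_num)
  have h3 : Real.sqrt 3 ^ 2 = 3 := Real.sq_sqrt (by norm_num)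
  obtain ⟨-, -, -, cw₁, cw₂, cw₃, -⟩ := hexUp_inner_apply (A.symm ν)
  have dw₁ : ⟪A (barlowPos 1 (Real.sqrt (2 / 3)) constHagg 1 0 0), ν⟫_ℝ = -Real.sqrt (2 / 3) := by rw [key, cw₁, h0, h1, h2]; ring
  have dw₂ : ⟪A (barlowPos 1 (Real.sqrt (2 / 3)) constHagg 1 (-1) 0), ν⟫_ℝ = -Real.sqrt (2 / 3) := by rw [key, cw₂, h0, h1, h2]; ring
  have dw₃ : ⟪A (barlowPos 1 (Real.sqrt (2 / 3)) constHagg 1 0 (-1)), ν⟫_ℝ = -Real.sqrt (2 / 3) := by rw [key, cw₃, h1, h2]; ring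
  have hk3 : (K.card : ℝ) ≤ 3 := by exact_mod_cast hK
  -- nonnegativity of the three credits
  have n₁ : (0 : ℝ) ≤ (if (∃ u ∈ K, 1 / 2 < ⟪u, A (barlowPos 1 (Real.sqrt (2 / 3)) constHagg 1 0 0)⟫_ℝ) ∨ ⟪A (barlowPos 1 (Real.sqrt (2 / 3)) constHagg 1 0 0), ν⟫_ℝ ≤ -t then (1 : ℝ) else 0) := by split_ifs <;> norm_num
  have n₂ : (0 : ℝ) ≤ (if (∃ u ∈ K, 1 / 2 < ⟪u, A (barlowPos 1 (Real.sqrt (2 / 3)) constHagg 1 (-1) 0)⟫_ℝ) ∨ ⟪A (barlowPos 1 (Real.sqrt (2 / 3)) constHagg 1 (-1) 0), ν⟫_ℝ ≤ -t then (1 : ℝ) else 0) := by split_ifs <;> norm_num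
  have n₃ : (0 : ℝ) ≤ (if (∃ u ∈ K, 1 / 2 < ⟪u, A (barlowPos 1 (Real.sqrt (2 / 3)) constHagg 1 0 (-1))⟫_ℝ) ∨ ⟪A (barlowPos 1 (Real.sqrt (2 / 3)) constHagg 1 0 (-1)), ν⟫_ℝ ≤ -t then (1 : ℝ) else 0) := by split_ifs <;> norm_num
  by_cases hth : t ≤ Real.sqrt (2 / 3)
  · -- all three up bonds are submerged
    rw [if_pos (Or.inr (by rw [dw₁]; linarith)), if_pos (Or.inr (by rw [dw₂]; linarith)),
      if_pos (Or.inr (by rw [dw₃]; linarith))]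
    linarith
  push Not at hth
  -- coordinates of the contacts
  have hcon : ∀ u ∈ K, (A.symm u) 0 ^ 2 + (A.symm u) 1 ^ 2 + (A.symm u) 2 ^ 2 = 1 ∧
      Real.sqrt (2 / 3) < (A.symm u) 2 ∧
      ⟪u, A (barlowPos 1 (Real.sqrt (2 / 3)) constHagg 1 0 0)⟫_ℝ =
        1 / 2 * (A.symm u) 0 + Real.sqrt 3 / 6 * (A.symm u) 1 + Real.sqrt (2 / 3) * (A.symm u) 2 ∧
      ⟪u, A (barlowPos 1 (Real.sqrt (2 / 3)) constHagg 1 (-1) 0)⟫_ℝ =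
        -(1 / 2) * (A.symm u) 0 + Real.sqrt 3 / 6 * (A.symm u) 1 + Real.sqrt (2 / 3) * (A.symm u) 2 ∧
      ⟪u, A (barlowPos 1 (Real.sqrt (2 / 3)) constHagg 1 0 (-1))⟫_ℝ =
        -(Real.sqrt 3 / 3) * (A.symm u) 1 + Real.sqrt (2 / 3) * (A.symm u) 2 := by
    intro u hu
    obtain ⟨-, -, -, c₁, c₂, c₃, -⟩ := hexUp_inner_apply (A.symm u)
    have hn : ‖A.symm u‖ = 1 := by rw [LinearIsometryEquiv.norm_map]; exact (hK1 u hu).1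
    have hsq := norm_sq_fin_three (A.symm u)
    rw [hn, one_pow] at hsq
    have hd : ⟪u, ν⟫_ℝ = -(A.symm u) 2 := by
      rw [← A.symm.inner_map_map u ν, inner_fin_three, h0, h1, h2]; ring
    refine ⟨hsq.symm, ?_, by rw [key2, c₁], by rw [key2, c₂], by rw [key2, c₃]⟩
    have := (hK1 u hu).2; rw [hd] at this; linarith
  have hpair : ∀ u ∈ K, ∀ u' ∈ K, u ≠ u' →
      (A.symm u) 0 * (A.symm u') 0 + (A.symm u) 1 * (A.symm u') 1 + (A.symm u) 2 * (A.symm u') 2 ≤ 1 / 2 := by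
    intro u hu u' hu' hne
    rw [← inner_fin_three, A.symm.inner_map_map]; exact hK2 u hu u' hu' hne
  rcases Nat.lt_or_ge K.card 3 with hk | hk
  · -- at most two contacts: any one of them blocks two up bonds
    have hk2 : (K.card : ℝ) ≤ 2 := by exact_mod_cast Nat.lt_succ_iff.mp hk
    rcases K.eq_empty_or_nonempty with hK0 | ⟨u, hu⟩
    · have : (K.card : ℝ) = 0 := by rw [hK0, card_empty, Nat.cast_zero]
      linarith
    obtain ⟨hsq, hz, s₁, s₂, s₃⟩ := hcon u hu
    have two := upBonds_two_blocked hsq hz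
    have i₁ : (if 1 / 2 < 1 / 2 * (A.symm u) 0 + Real.sqrt 3 / 6 * (A.symm u) 1 + Real.sqrt (2 / 3) * (A.symm u) 2
        then (1 : ℝ) else 0) ≤ (if (∃ u ∈ K, 1 / 2 < ⟪u, A (barlowPos 1 (Real.sqrt (2 / 3)) constHagg 1 0 0)⟫_ℝ) ∨ ⟪A (barlowPos 1 (Real.sqrt (2 / 3)) constHagg 1 0 0), ν⟫_ℝ ≤ -t then (1 : ℝ) else 0) := by
      by_cases hb : 1 / 2 < 1 / 2 * (A.symm u) 0 + Real.sqrt 3 / 6 * (A.symm u) 1 + Real.sqrt (2 / 3) * (A.symm u) 2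
      · rw [if_pos hb, if_pos (Or.inl ⟨u, hu, by rwa [s₁]⟩)]
      · rw [if_neg hb]; exact n₁
    have i₂ : (if 1 / 2 < -(1 / 2) * (A.symm u) 0 + Real.sqrt 3 / 6 * (A.symm u) 1 + Real.sqrt (2 / 3) * (A.symm u) 2
        then (1 : ℝ) else 0) ≤ (if (∃ u ∈ K, 1 / 2 < ⟪u, A (barlowPos 1 (Real.sqrt (2 / 3)) constHagg 1 (-1) 0)⟫_ℝ) ∨ ⟪A (barlowPos 1 (Real.sqrt (2 / 3)) constHagg 1 (-1) 0), ν⟫_ℝ ≤ -t then (1 : ℝ) else 0) := by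
      by_cases hb : 1 / 2 < -(1 / 2) * (A.symm u) 0 + Real.sqrt 3 / 6 * (A.symm u) 1 + Real.sqrt (2 / 3) * (A.symm u) 2
      · rw [if_pos hb, if_pos (Or.inl ⟨u, hu, by rwa [s₂]⟩)]
      · rw [if_neg hb]; exact n₂
    have i₃ : (if 1 / 2 < -(Real.sqrt 3 / 3) * (A.symm u) 1 + Real.sqrt (2 / 3) * (A.symm u) 2
        then (1 : ℝ) else 0) ≤ (if (∃ u ∈ K, 1 / 2 < ⟪u, A (barlowPos 1 (Real.sqrt (2 / 3)) constHagg 1 0 (-1))⟫_ℝ) ∨ ⟪A (barlowPos 1 (Real.sqrt (2 / 3)) constHagg 1 0 (-1)), ν⟫_ℝ ≤ -t then (1 : ℝ) else 0) := by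
      by_cases hb : 1 / 2 < -(Real.sqrt 3 / 3) * (A.symm u) 1 + Real.sqrt (2 / 3) * (A.symm u) 2
      · rw [if_pos hb, if_pos (Or.inl ⟨u, hu, by rwa [s₃]⟩)]
      · rw [if_neg hb]; exact n₃
    linarith
  · -- three contacts block all three up bonds
    classical
    have hK3 : K.card = 3 := le_antisymm hK hk
    obtain ⟨u₁, u₂, u₃, n12, n13, n23, hKe⟩ := card_eq_three.1 hK3
    have m1 : u₁ ∈ K := by rw [hKe]; simp only [mem_insert, mem_singleton, true_or]
    have m2 : u₂ ∈ K := by rw [hKe]; simp only [mem_insert, mem_singleton, true_or, or_true]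
    have m3 : u₃ ∈ K := by rw [hKe]; simp only [mem_insert, mem_singleton, or_true]
    obtain ⟨-, hz₁, a₁, b₁, c₁⟩ := hcon u₁ m1
    obtain ⟨-, hz₂, a₂, b₂, c₂⟩ := hcon u₂ m2
    obtain ⟨-, hz₃, a₃, b₃, c₃⟩ := hcon u₃ m3
    have p12 := hpair u₁ m1 u₂ m2 n12
    have p13 := hpair u₁ m1 u₃ m3 n13
    have p23 := hpair u₂ m2 u₃ m3 n23
    have hr₁ : (1 / 2 : ℝ) ^ 2 + (Real.sqrt 3 / 6) ^ 2 = 1 / 3 := by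
      rw [div_pow (Real.sqrt 3), h3]; norm_num
    have hr₂ : (-(1 / 2) : ℝ) ^ 2 + (Real.sqrt 3 / 6) ^ 2 = 1 / 3 := by
      rw [div_pow (Real.sqrt 3), h3]; norm_num
    have hr₃ : (0 : ℝ) ^ 2 + (-(Real.sqrt 3 / 3)) ^ 2 = 1 / 3 := by
      rw [neg_sq, div_pow (Real.sqrt 3), h3]; norm_num
    have bl₁ : ∃ u ∈ K, 1 / 2 < ⟪u, A (barlowPos 1 (Real.sqrt (2 / 3)) constHagg 1 0 0)⟫_ℝ := by
      by_contra hno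
      push Not at hno
      have e1 := hno u₁ m1; have e2 := hno u₂ m2; have e3 := hno u₃ m3
      rw [a₁] at e1; rw [a₂] at e2; rw [a₃] at e3
      exact upBond_blocked_of_three hr₁ hz₁ hz₂ hz₃ p12 p13 p23 e1 e2 e3
    have bl₂ : ∃ u ∈ K, 1 / 2 < ⟪u, A (barlowPos 1 (Real.sqrt (2 / 3)) constHagg 1 (-1) 0)⟫_ℝ := by
      by_contra hno
      push Not at hno
      have e1 := hno u₁ m1; have e2 := hno u₂ m2; have e3 := hno u₃ m3
      rw [b₁] at e1; rw [b₂] at e2; rw [b₃] at e3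
      exact upBond_blocked_of_three hr₂ hz₁ hz₂ hz₃ p12 p13 p23 e1 e2 e3
    have bl₃ : ∃ u ∈ K, 1 / 2 < ⟪u, A (barlowPos 1 (Real.sqrt (2 / 3)) constHagg 1 0 (-1))⟫_ℝ := by
      by_contra hno
      push Not at hno
      have e1 := hno u₁ m1; have e2 := hno u₂ m2; have e3 := hno u₃ m3
      rw [c₁] at e1; rw [c₂] at e2; rw [c₃] at e3
      exact upBond_blocked_of_three hr₃ hz₁ hz₂ hz₃ p12 p13 p23 (by linarith) (by linarith) (by linarith)
    rw [if_pos (Or.inl bl₁), if_pos (Or.inl bl₂), if_pos (Or.inl bl₃), hK3]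
    norm_num


/-! ### The core: the budget in a frame whose up-triple is `ν`-below -/

/-- **CORE.**  In a lattice frame `A` whose axis is within `70.5°` of `−ν` and whose three up bonds
`A w_i` are strictly `ν`-below, the pred-slot budget holds for the hex representatives `g_j = ±A h_j`:
the landed cap budget of the star `A U₀` (`frameCapBudget_sum_le`) is compared pair by pair
(`pair_hex_le`, `pair_hex_le'`, `pair_down_le`); the only loss is `½` per LEVEL hex pair, harmless by
integrality unless two hex pairs are level, which forces `ν = −A e₃` (`predSlotBudget_axis`). -/
theorem predSlotBudget_core (A : EuclideanSpace ℝ (Fin 3) ≃ₗᵢ[ℝ] EuclideanSpace ℝ (Fin 3))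
    (ν : EuclideanSpace ℝ (Fin 3)) (hν : ‖ν‖ = 1)
    (haxis : ⟪ν, A (EuclideanSpace.single (2 : Fin 3) (1 : ℝ))⟫_ℝ ≤ -(1 / 3)) (t : ℝ) (ht : 0 < t)
    (K : Finset (EuclideanSpace ℝ (Fin 3))) (hK : K.card ≤ 3)
    (hK1 : ∀ u ∈ K, ‖u‖ = 1 ∧ ⟪u, ν⟫_ℝ ≤ -t) (hK2 : ∀ u ∈ K, ∀ u' ∈ K, u ≠ u' → ⟪u, u'⟫_ℝ ≤ 1 / 2)
    (g₁ g₂ g₃ : EuclideanSpace ℝ (Fin 3))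
    (hg₁ : g₁ = A (barlowPos 1 (Real.sqrt (2 / 3)) constHagg 0 1 0) ∨ g₁ = -A (barlowPos 1 (Real.sqrt (2 / 3)) constHagg 0 1 0))
    (hg₂ : g₂ = A (barlowPos 1 (Real.sqrt (2 / 3)) constHagg 0 0 1) ∨ g₂ = -A (barlowPos 1 (Real.sqrt (2 / 3)) constHagg 0 0 1))
    (hg₃ : g₃ = A (barlowPos 1 (Real.sqrt (2 / 3)) constHagg 0 1 (-1)) ∨ g₃ = -A (barlowPos 1 (Real.sqrt (2 / 3)) constHagg 0 1 (-1)))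
    (hw₁ : ⟪A (barlowPos 1 (Real.sqrt (2 / 3)) constHagg 1 0 0), ν⟫_ℝ < 0) (hw₂ : ⟪A (barlowPos 1 (Real.sqrt (2 / 3)) constHagg 1 (-1) 0), ν⟫_ℝ < 0)
    (hw₃ : ⟪A (barlowPos 1 (Real.sqrt (2 / 3)) constHagg 1 0 (-1)), ν⟫_ℝ < 0) :
    (K.card : ℝ) ≤
      (if (∃ u ∈ K, 1 / 2 < ⟪u, if ⟪g₁, ν⟫_ℝ < 0 then g₁ else -g₁⟫_ℝ) ∨
          ⟪(if ⟪g₁, ν⟫_ℝ < 0 then g₁ else -g₁), ν⟫_ℝ ≤ -t then (1 : ℝ) else 0) +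
      (if (∃ u ∈ K, 1 / 2 < ⟪u, if ⟪g₂, ν⟫_ℝ < 0 then g₂ else -g₂⟫_ℝ) ∨
          ⟪(if ⟪g₂, ν⟫_ℝ < 0 then g₂ else -g₂), ν⟫_ℝ ≤ -t then (1 : ℝ) else 0) +
      (if (∃ u ∈ K, 1 / 2 < ⟪u, if ⟪g₃, ν⟫_ℝ < 0 then g₃ else -g₃⟫_ℝ) ∨
          ⟪(if ⟪g₃, ν⟫_ℝ < 0 then g₃ else -g₃), ν⟫_ℝ ≤ -t then (1 : ℝ) else 0) +
      (if (∃ u ∈ K, 1 / 2 < ⟪u, A (barlowPos 1 (Real.sqrt (2 / 3)) constHagg 1 0 0)⟫_ℝ) ∨ ⟪A (barlowPos 1 (Real.sqrt (2 / 3)) constHagg 1 0 0), ν⟫_ℝ ≤ -t then (1 : ℝ) else 0) +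
      (if (∃ u ∈ K, 1 / 2 < ⟪u, A (barlowPos 1 (Real.sqrt (2 / 3)) constHagg 1 (-1) 0)⟫_ℝ) ∨ ⟪A (barlowPos 1 (Real.sqrt (2 / 3)) constHagg 1 (-1) 0), ν⟫_ℝ ≤ -t then (1 : ℝ) else 0) +
      (if (∃ u ∈ K, 1 / 2 < ⟪u, A (barlowPos 1 (Real.sqrt (2 / 3)) constHagg 1 0 (-1))⟫_ℝ) ∨ ⟪A (barlowPos 1 (Real.sqrt (2 / 3)) constHagg 1 0 (-1)), ν⟫_ℝ ≤ -t then (1 : ℝ) else 0) := by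
  obtain ⟨ew₂, ew₃⟩ := upBonds_eq_neg
  have h12 := frameCapBudget_sum_le A ν hν t ht K hK hK1 hK2
  rw [ew₂, ew₃] at h12
  simp only [List.map_cons, List.map_nil, List.sum_cons, List.sum_nil, add_zero, map_neg, neg_neg] at h12
  -- pair comparisons
  have P1 : ((if ⟪A (barlowPos 1 (Real.sqrt (2 / 3)) constHagg 0 1 0), ν⟫_ℝ < 0 ∧ ((∃ u ∈ K, 1 / 2 < ⟪u, A (barlowPos 1 (Real.sqrt (2 / 3)) constHagg 0 1 0)⟫_ℝ) ∨ ⟪A (barlowPos 1 (Real.sqrt (2 / 3)) constHagg 0 1 0), ν⟫_ℝ ≤ -t) then (1 : ℝ) else 0) +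
        1 / 2 * (if ⟪A (barlowPos 1 (Real.sqrt (2 / 3)) constHagg 0 1 0), ν⟫_ℝ = 0 ∧ (∃ u ∈ K, 1 / 2 < ⟪u, A (barlowPos 1 (Real.sqrt (2 / 3)) constHagg 0 1 0)⟫_ℝ) then (1 : ℝ) else 0)) +
      ((if ⟪-A (barlowPos 1 (Real.sqrt (2 / 3)) constHagg 0 1 0), ν⟫_ℝ < 0 ∧ ((∃ u ∈ K, 1 / 2 < ⟪u, -A (barlowPos 1 (Real.sqrt (2 / 3)) constHagg 0 1 0)⟫_ℝ) ∨ ⟪-A (barlowPos 1 (Real.sqrt (2 / 3)) constHagg 0 1 0), ν⟫_ℝ ≤ -t) then (1 : ℝ) else 0) +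
        1 / 2 * (if ⟪-A (barlowPos 1 (Real.sqrt (2 / 3)) constHagg 0 1 0), ν⟫_ℝ = 0 ∧ (∃ u ∈ K, 1 / 2 < ⟪u, -A (barlowPos 1 (Real.sqrt (2 / 3)) constHagg 0 1 0)⟫_ℝ) then (1 : ℝ) else 0)) ≤
      (if (∃ u ∈ K, 1 / 2 < ⟪u, if ⟪g₁, ν⟫_ℝ < 0 then g₁ else -g₁⟫_ℝ) ∨
          ⟪(if ⟪g₁, ν⟫_ℝ < 0 then g₁ else -g₁), ν⟫_ℝ ≤ -t then (1 : ℝ) else 0) +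
        1 / 2 * (if ⟪A (barlowPos 1 (Real.sqrt (2 / 3)) constHagg 0 1 0), ν⟫_ℝ = 0 then (1 : ℝ) else 0) := by
    rcases hg₁ with rfl | rfl
    · exact pair_hex_le _ ν K t
    · exact pair_hex_le' _ ν K t
  have P2 : ((if ⟪A (barlowPos 1 (Real.sqrt (2 / 3)) constHagg 0 0 1), ν⟫_ℝ < 0 ∧ ((∃ u ∈ K, 1 / 2 < ⟪u, A (barlowPos 1 (Real.sqrt (2 / 3)) constHagg 0 0 1)⟫_ℝ) ∨ ⟪A (barlowPos 1 (Real.sqrt (2 / 3)) constHagg 0 0 1), ν⟫_ℝ ≤ -t) then (1 : ℝ) else 0) +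
        1 / 2 * (if ⟪A (barlowPos 1 (Real.sqrt (2 / 3)) constHagg 0 0 1), ν⟫_ℝ = 0 ∧ (∃ u ∈ K, 1 / 2 < ⟪u, A (barlowPos 1 (Real.sqrt (2 / 3)) constHagg 0 0 1)⟫_ℝ) then (1 : ℝ) else 0)) +
      ((if ⟪-A (barlowPos 1 (Real.sqrt (2 / 3)) constHagg 0 0 1), ν⟫_ℝ < 0 ∧ ((∃ u ∈ K, 1 / 2 < ⟪u, -A (barlowPos 1 (Real.sqrt (2 / 3)) constHagg 0 0 1)⟫_ℝ) ∨ ⟪-A (barlowPos 1 (Real.sqrt (2 / 3)) constHagg 0 0 1), ν⟫_ℝ ≤ -t) then (1 : ℝ) else 0) +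
        1 / 2 * (if ⟪-A (barlowPos 1 (Real.sqrt (2 / 3)) constHagg 0 0 1), ν⟫_ℝ = 0 ∧ (∃ u ∈ K, 1 / 2 < ⟪u, -A (barlowPos 1 (Real.sqrt (2 / 3)) constHagg 0 0 1)⟫_ℝ) then (1 : ℝ) else 0)) ≤
      (if (∃ u ∈ K, 1 / 2 < ⟪u, if ⟪g₂, ν⟫_ℝ < 0 then g₂ else -g₂⟫_ℝ) ∨
          ⟪(if ⟪g₂, ν⟫_ℝ < 0 then g₂ else -g₂), ν⟫_ℝ ≤ -t then (1 : ℝ) else 0) +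
        1 / 2 * (if ⟪A (barlowPos 1 (Real.sqrt (2 / 3)) constHagg 0 0 1), ν⟫_ℝ = 0 then (1 : ℝ) else 0) := by
    rcases hg₂ with rfl | rfl
    · exact pair_hex_le _ ν K t
    · exact pair_hex_le' _ ν K t
  have P3 : ((if ⟪A (barlowPos 1 (Real.sqrt (2 / 3)) constHagg 0 1 (-1)), ν⟫_ℝ < 0 ∧ ((∃ u ∈ K, 1 / 2 < ⟪u, A (barlowPos 1 (Real.sqrt (2 / 3)) constHagg 0 1 (-1))⟫_ℝ) ∨ ⟪A (barlowPos 1 (Real.sqrt (2 / 3)) constHagg 0 1 (-1)), ν⟫_ℝ ≤ -t) then (1 : ℝ) else 0) +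
        1 / 2 * (if ⟪A (barlowPos 1 (Real.sqrt (2 / 3)) constHagg 0 1 (-1)), ν⟫_ℝ = 0 ∧ (∃ u ∈ K, 1 / 2 < ⟪u, A (barlowPos 1 (Real.sqrt (2 / 3)) constHagg 0 1 (-1))⟫_ℝ) then (1 : ℝ) else 0)) +
      ((if ⟪-A (barlowPos 1 (Real.sqrt (2 / 3)) constHagg 0 1 (-1)), ν⟫_ℝ < 0 ∧ ((∃ u ∈ K, 1 / 2 < ⟪u, -A (barlowPos 1 (Real.sqrt (2 / 3)) constHagg 0 1 (-1))⟫_ℝ) ∨ ⟪-A (barlowPos 1 (Real.sqrt (2 / 3)) constHagg 0 1 (-1)), ν⟫_ℝ ≤ -t) then (1 : ℝ) else 0) +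
        1 / 2 * (if ⟪-A (barlowPos 1 (Real.sqrt (2 / 3)) constHagg 0 1 (-1)), ν⟫_ℝ = 0 ∧ (∃ u ∈ K, 1 / 2 < ⟪u, -A (barlowPos 1 (Real.sqrt (2 / 3)) constHagg 0 1 (-1))⟫_ℝ) then (1 : ℝ) else 0)) ≤
      (if (∃ u ∈ K, 1 / 2 < ⟪u, if ⟪g₃, ν⟫_ℝ < 0 then g₃ else -g₃⟫_ℝ) ∨
          ⟪(if ⟪g₃, ν⟫_ℝ < 0 then g₃ else -g₃), ν⟫_ℝ ≤ -t then (1 : ℝ) else 0) +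
        1 / 2 * (if ⟪A (barlowPos 1 (Real.sqrt (2 / 3)) constHagg 0 1 (-1)), ν⟫_ℝ = 0 then (1 : ℝ) else 0) := by
    rcases hg₃ with rfl | rfl
    · exact pair_hex_le _ ν K t
    · exact pair_hex_le' _ ν K t
  have Q1 := pair_down_le (A (barlowPos 1 (Real.sqrt (2 / 3)) constHagg 1 0 0)) ν K t hw₁
  have Q2 := pair_down_le (A (barlowPos 1 (Real.sqrt (2 / 3)) constHagg 1 (-1) 0)) ν K t hw₂
  have Q3 := pair_down_le (A (barlowPos 1 (Real.sqrt (2 / 3)) constHagg 1 0 (-1))) ν K t hw₃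
  -- nonnegativity of the hex credits
  have n₁ : (0 : ℝ) ≤ (if (∃ u ∈ K, 1 / 2 < ⟪u, if ⟪g₁, ν⟫_ℝ < 0 then g₁ else -g₁⟫_ℝ) ∨
          ⟪(if ⟪g₁, ν⟫_ℝ < 0 then g₁ else -g₁), ν⟫_ℝ ≤ -t then (1 : ℝ) else 0) := by
    split_ifs <;> norm_num
  have n₂ : (0 : ℝ) ≤ (if (∃ u ∈ K, 1 / 2 < ⟪u, if ⟪g₂, ν⟫_ℝ < 0 then g₂ else -g₂⟫_ℝ) ∨
          ⟪(if ⟪g₂, ν⟫_ℝ < 0 then g₂ else -g₂), ν⟫_ℝ ≤ -t then (1 : ℝ) else 0) := by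
    split_ifs <;> norm_num
  have n₃ : (0 : ℝ) ≤ (if (∃ u ∈ K, 1 / 2 < ⟪u, if ⟪g₃, ν⟫_ℝ < 0 then g₃ else -g₃⟫_ℝ) ∨
          ⟪(if ⟪g₃, ν⟫_ℝ < 0 then g₃ else -g₃), ν⟫_ℝ ≤ -t then (1 : ℝ) else 0) := by
    split_ifs <;> norm_num
  by_cases hlev : (⟪A (barlowPos 1 (Real.sqrt (2 / 3)) constHagg 0 1 0), ν⟫_ℝ = 0 ∧ ⟪A (barlowPos 1 (Real.sqrt (2 / 3)) constHagg 0 0 1), ν⟫_ℝ = 0) ∨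
      (⟪A (barlowPos 1 (Real.sqrt (2 / 3)) constHagg 0 1 0), ν⟫_ℝ = 0 ∧ ⟪A (barlowPos 1 (Real.sqrt (2 / 3)) constHagg 0 1 (-1)), ν⟫_ℝ = 0) ∨
      (⟪A (barlowPos 1 (Real.sqrt (2 / 3)) constHagg 0 0 1), ν⟫_ℝ = 0 ∧ ⟪A (barlowPos 1 (Real.sqrt (2 / 3)) constHagg 0 1 (-1)), ν⟫_ℝ = 0)
  · -- two level hex pairs: `ν = −A e₃`
    have key : ∀ x, ⟪A x, ν⟫_ℝ = ⟪x, A.symm ν⟫_ℝ := fun x => by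
      rw [← A.inner_map_map x (A.symm ν), LinearIsometryEquiv.apply_symm_apply]
    obtain ⟨c₁, c₂, c₃, -, -, -, ce⟩ := hexUp_inner_apply (A.symm ν)
    have s3 : Real.sqrt 3 ≠ 0 := Real.sqrt_ne_zero'.2 (by norm_num)
    have h01 : (A.symm ν) 0 = 0 ∧ (A.symm ν) 1 = 0 := by
      rcases hlev with ⟨l1, l2⟩ | ⟨l1, l3⟩ | ⟨l2, l3⟩
      · rw [key, c₁] at l1; rw [key, c₂, l1] at l2
        refine ⟨l1, ?_⟩
        have : Real.sqrt 3 * (A.symm ν) 1 = 0 := by linarith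
        rcases mul_eq_zero.1 this with h | h
        · exact absurd h s3
        · exact h
      · rw [key, c₁] at l1; rw [key, c₃, l1] at l3
        refine ⟨l1, ?_⟩
        have : Real.sqrt 3 * (A.symm ν) 1 = 0 := by linarith
        rcases mul_eq_zero.1 this with h | h
        · exact absurd h s3
        · exact h
      · rw [key, c₂] at l2; rw [key, c₃] at l3
        refine ⟨by linarith, ?_⟩
        have : Real.sqrt 3 * (A.symm ν) 1 = 0 := by linarith
        rcases mul_eq_zero.1 this with h | h
        · exact absurd h s3
        · exact h
    have hn : ‖A.symm ν‖ = 1 := by rw [LinearIsometryEquiv.norm_map, hν]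
    have hsq := norm_sq_fin_three (A.symm ν)
    rw [hn, one_pow, h01.1, h01.2] at hsq
    have hax' : (A.symm ν) 2 ≤ -(1 / 3) := by
      rw [real_inner_comm, key, ce] at haxis; exact haxis
    have hsq' : (A.symm ν) 2 ^ 2 = 1 := by linarith only [hsq]
    have hprod : ((A.symm ν) 2 + 1) * ((A.symm ν) 2 - 1) = 0 := by ring_nf; linarith only [hsq']
    have h2 : (A.symm ν) 2 = -1 := by
      rcases mul_eq_zero.1 hprod with h | h
      · linarith only [h]
      · exfalso; linarith only [h, hax']
    have hax := predSlotBudget_axis A ν t K hK hK1 hK2 h01.1 h01.2 h2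
    linarith only [hax, n₁, n₂, n₃]
  · -- at most one level hex pair: the loss is at most `½`
    have hS : (if ⟪A (barlowPos 1 (Real.sqrt (2 / 3)) constHagg 0 1 0), ν⟫_ℝ = 0 then (1 : ℝ) else 0) +
        (if ⟪A (barlowPos 1 (Real.sqrt (2 / 3)) constHagg 0 0 1), ν⟫_ℝ = 0 then (1 : ℝ) else 0) +
        (if ⟪A (barlowPos 1 (Real.sqrt (2 / 3)) constHagg 0 1 (-1)), ν⟫_ℝ = 0 then (1 : ℝ) else 0) ≤ 1 := by
      by_cases l1 : ⟪A (barlowPos 1 (Real.sqrt (2 / 3)) constHagg 0 1 0), ν⟫_ℝ = 0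
      · have l2 : ¬ ⟪A (barlowPos 1 (Real.sqrt (2 / 3)) constHagg 0 0 1), ν⟫_ℝ = 0 := fun h => hlev (Or.inl ⟨l1, h⟩)
        have l3 : ¬ ⟪A (barlowPos 1 (Real.sqrt (2 / 3)) constHagg 0 1 (-1)), ν⟫_ℝ = 0 :=
          fun h => hlev (Or.inr (Or.inl ⟨l1, h⟩))
        rw [if_pos l1, if_neg l2, if_neg l3]; norm_num
      · by_cases l2 : ⟪A (barlowPos 1 (Real.sqrt (2 / 3)) constHagg 0 0 1), ν⟫_ℝ = 0
        · have l3 : ¬ ⟪A (barlowPos 1 (Real.sqrt (2 / 3)) constHagg 0 1 (-1)), ν⟫_ℝ = 0 :=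
            fun h => hlev (Or.inr (Or.inr ⟨l2, h⟩))
          rw [if_neg l1, if_pos l2, if_neg l3]; norm_num
        · rw [if_neg l1, if_neg l2]; split_ifs <;> norm_num
    refine natCast_le_of_le_indicators_add_half K.card _ _ _ _ _ _ ?_
    linarith only [h12, P1, P2, P3, Q1, Q2, Q3, hS]


/-- **THE PRED-SLOT BUDGET WHEN THE UP-TRIPLE IS `ν`-BELOW** (the registered brick `stub_predSlotBudget70`
under the extra hypothesis that the three up bonds `A·pos_ε(1, −o)` are strictly `ν`-below — automatic in
the open basal cone `⟪ν, A e₃⟫ < −1/√3`, and true in part of the band beyond it): the landed cap budget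
read backwards (`predSlotBudget_core`; letter `ε = −1` through the half-turn frame `A ∘ R_π`). -/
theorem predSlotBudget_of_upTriple_below :
    ∀ A : EuclideanSpace ℝ (Fin 3) ≃ₗᵢ[ℝ] EuclideanSpace ℝ (Fin 3), ∀ ν : EuclideanSpace ℝ (Fin 3), ‖ν‖ = 1 →
      ⟪ν, A (EuclideanSpace.single (2 : Fin 3) (1 : ℝ))⟫_ℝ ≤ -(1 / 3) →
      ∀ t : ℝ, 0 < t → ∀ K : Finset (EuclideanSpace ℝ (Fin 3)), K.card ≤ 3 →
        (∀ u ∈ K, ‖u‖ = 1 ∧ ⟪u, ν⟫_ℝ ≤ -t) →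
        (∀ u ∈ K, ∀ u' ∈ K, u ≠ u' →
          ⟪u, u'⟫_ℝ = 1 / 2 ∨ ⟪u, u'⟫_ℝ = 0 ∨ ⟪u, u'⟫_ℝ = -1 / 2) →
        ∀ ε : ℤ, (ε = 1 ∨ ε = -1) →
        (∀ o ∈ threeOffsets (-ε),
          ⟪A (barlowPos 1 (Real.sqrt (2 / 3)) (fun _ : ℤ => ε) 1 (-o.1) (-o.2)), ν⟫_ℝ < 0) →
        (K.card : ℝ) ≤
          (if (∃ u ∈ K, 1 / 2 < ⟪u, if ⟪A (barlowPos 1 (Real.sqrt (2 / 3)) constHagg 0 1 0), ν⟫_ℝ < 0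
                then A (barlowPos 1 (Real.sqrt (2 / 3)) constHagg 0 1 0)
                else -A (barlowPos 1 (Real.sqrt (2 / 3)) constHagg 0 1 0)⟫_ℝ) ∨
              ⟪(if ⟪A (barlowPos 1 (Real.sqrt (2 / 3)) constHagg 0 1 0), ν⟫_ℝ < 0
                then A (barlowPos 1 (Real.sqrt (2 / 3)) constHagg 0 1 0)
                else -A (barlowPos 1 (Real.sqrt (2 / 3)) constHagg 0 1 0)), ν⟫_ℝ ≤ -t
            then (1 : ℝ) else 0) +
          (if (∃ u ∈ K, 1 / 2 < ⟪u, if ⟪A (barlowPos 1 (Real.sqrt (2 / 3)) constHagg 0 0 1), ν⟫_ℝ < 0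
                then A (barlowPos 1 (Real.sqrt (2 / 3)) constHagg 0 0 1)
                else -A (barlowPos 1 (Real.sqrt (2 / 3)) constHagg 0 0 1)⟫_ℝ) ∨
              ⟪(if ⟪A (barlowPos 1 (Real.sqrt (2 / 3)) constHagg 0 0 1), ν⟫_ℝ < 0
                then A (barlowPos 1 (Real.sqrt (2 / 3)) constHagg 0 0 1)
                else -A (barlowPos 1 (Real.sqrt (2 / 3)) constHagg 0 0 1)), ν⟫_ℝ ≤ -t
            then (1 : ℝ) else 0) +
          (if (∃ u ∈ K, 1 / 2 < ⟪u, if ⟪A (barlowPos 1 (Real.sqrt (2 / 3)) constHagg 0 1 (-1)), ν⟫_ℝ < 0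
                then A (barlowPos 1 (Real.sqrt (2 / 3)) constHagg 0 1 (-1))
                else -A (barlowPos 1 (Real.sqrt (2 / 3)) constHagg 0 1 (-1))⟫_ℝ) ∨
              ⟪(if ⟪A (barlowPos 1 (Real.sqrt (2 / 3)) constHagg 0 1 (-1)), ν⟫_ℝ < 0
                then A (barlowPos 1 (Real.sqrt (2 / 3)) constHagg 0 1 (-1))
                else -A (barlowPos 1 (Real.sqrt (2 / 3)) constHagg 0 1 (-1))), ν⟫_ℝ ≤ -t
            then (1 : ℝ) else 0) +
          (((threeOffsets (-ε)).filter fun o =>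
            (∃ u ∈ K, 1 / 2 < ⟪u, A (barlowPos 1 (Real.sqrt (2 / 3)) (fun _ : ℤ => ε) 1 (-o.1) (-o.2))⟫_ℝ) ∨
              ⟪A (barlowPos 1 (Real.sqrt (2 / 3)) (fun _ : ℤ => ε) 1 (-o.1) (-o.2)), ν⟫_ℝ ≤ -t).card : ℝ) := by
  intro A ν hν haxis t ht K hK hK1 hK2 ε hε hup
  have hK2' : ∀ u ∈ K, ∀ u' ∈ K, u ≠ u' → ⟪u, u'⟫_ℝ ≤ 1 / 2 := by
    intro u hu u' hu' hne
    rcases hK2 u hu u' hu' hne with h | h | h <;> rw [h] <;> norm_num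
  rcases hε with rfl | rfl
  · -- letter `+1`: the frame `A` itself
    have hT : threeOffsets (-1) = {(0, 0), (1, 0), (0, 1)} := by simp [threeOffsets]
    have hc1 : (fun _ : ℤ => (1 : ℤ)) = constHagg := rfl
    rw [hT, card_filter, sum_insert (by decide), sum_insert (by decide), sum_singleton]
    push_cast
    simp only [neg_zero, hc1]
    have hw₁ := hup (0, 0) (by rw [hT]; decide)
    have hw₂ := hup (1, 0) (by rw [hT]; decide)
    have hw₃ := hup (0, 1) (by rw [hT]; decide)
    simp only [neg_zero, hc1] at hw₁ hw₂ hw₃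
    have hc := predSlotBudget_core A ν hν haxis t ht K hK hK1 hK2' _ _ _ (Or.inl rfl) (Or.inl rfl)
      (Or.inl rfl) hw₁ hw₂ hw₃
    linarith only [hc]
  · -- letter `−1`: the half-turn frame `A ∘ R_π`
    have hT : threeOffsets (-(-1 : ℤ)) = {(0, 0), (-1, 0), (0, -1)} := by simp [threeOffsets]
    rw [hT, card_filter, sum_insert (by decide), sum_insert (by decide), sum_singleton]
    push_cast
    simp only [neg_zero]
    have hw₁ := hup (0, 0) (by rw [hT]; decide)
    have hw₂ := hup (-1, 0) (by rw [hT]; decide)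
    have hw₃ := hup (0, -1) (by rw [hT]; decide)
    simp only [neg_zero, neg_neg] at hw₁ hw₂ hw₃
    obtain ⟨r₁, r₂, r₃, s₁, s₂, s₃, re⟩ := halfTurn_bonds
    set R := (((ℝ ∙ (EuclideanSpace.single (2 : Fin 3) (1 : ℝ)))ᗮ.reflection).trans (LinearIsometryEquiv.neg ℝ)) with hR
    have haxis' : ⟪ν, (R.trans A) (EuclideanSpace.single (2 : Fin 3) (1 : ℝ))⟫_ℝ ≤ -(1 / 3) := by
      rw [LinearIsometryEquiv.trans_apply, re]; exact haxis
    have hc := predSlotBudget_core (R.trans A) ν hν haxis' t ht K hK hK1 hK2'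
      (A (barlowPos 1 (Real.sqrt (2 / 3)) constHagg 0 1 0)) (A (barlowPos 1 (Real.sqrt (2 / 3)) constHagg 0 0 1))
      (A (barlowPos 1 (Real.sqrt (2 / 3)) constHagg 0 1 (-1)))
      (Or.inr (by rw [LinearIsometryEquiv.trans_apply, r₁, map_neg, neg_neg]))
      (Or.inr (by rw [LinearIsometryEquiv.trans_apply, r₂, map_neg, neg_neg]))
      (Or.inr (by rw [LinearIsometryEquiv.trans_apply, r₃, map_neg, neg_neg]))
      (by rw [LinearIsometryEquiv.trans_apply, s₁]; exact hw₁)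
      (by rw [LinearIsometryEquiv.trans_apply, s₂]; exact hw₂)
      (by rw [LinearIsometryEquiv.trans_apply, s₃]; exact hw₃)
    simp only [LinearIsometryEquiv.trans_apply, s₁, s₂, s₃] at hc
    linarith only [hc]

end Summit.Ventures.Crystal3D.Theorems

end
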